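import Mathlib
import HarnessLib
import Summits.NavierStokesRegularity.NavierStokesRegularity.Theorems.PoloidalWindowDoorLrcModEntireQ4WebPackage
import Summits.NavierStokesRegularity.NavierStokesRegularity.Theorems.PoloidalWindowDoorLrcModEntireCurvedWebTools
import Summits.NavierStokesRegularity.NavierStokesRegularity.Theorems.PoloidalWindowDoorLrcModEntireRidgeGlobalBranchUnique

/-!
# Route `PoloidalWindowDoor`, item `LrcModEntire` (stmt-NavierStokesRegularity-20428), cells (Q4-curved)/(Q4-sonic, curved) of the (TH) column —
# THE WEB FUNCTION OVER A CURVED BRANCH: existence, smoothness, and the six web identities on a height window (steps 1–9 of the Fermi-frame web package)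

Cell ns-regularity-ideate, stub-worker seat ns-poloidal-K2-p2 g16 under the LEAD of item 20428 (ns-poloidal-K2-p3 g16);
`--supports stmt-NavierStokesRegularity-20428 --as helper`.  Memo `Cruxes/LrcModEntire/T2B-g16-sonic.md` §3: «RECOMMENDED NEXT KERNEL STEP: `curved_web_package`
(Fermi coordinates `(s,n,z) ↦ Γ(s) + nν(s) + z e₂` …)».  This file is the ¬line analogue of steps 1–9 of LEAD g16's `…Q4LineCore.q4line_core` /
`…Q4WebPackage.line_web_package`, with NO line literal: from the conjuncts of the (Q4) package (skeleton twist_split v10, stubs `stub_Q4curved` / `stub_Q4sonic`;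
hypothesis names of `line_web_package` + the re-entry clause `hUcrit`) it produces

* the WEB FUNCTION `G(s,z) ∈ (−r,r)` of the hull limit over the curved limit branch `Γ` (the unique strict maximiser of the cross-section at `(s,z)`, time `τ = 0`),
  `C^∞` on the height window `|z| < δ` (`…CurvedWebTools.contDiffAt_criticalPoint_of_contDiffAt`; `Γ` is `C^∞`, not `C^ω`), with `G(s,0) = 0`;
* horizontal criticality of `U₂(−1,·)` at every web point `W(s,z) = Γ s + G(s,z)·JΓ′ s + z·e₂` (web Fermat law, port-2's `webData_of_fderiv_uncurry`), the value
  `σU₂(−1, W(s,z)) = R(0,z)`, strict `JΓ′`-concavity, `R(0,·) ∈ C^∞` on `|z| < δ`;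
* the curvature function `κf(z) = −Δₕ(σU₂(−1,·))(W(0,z))`, differentiable on `|z| < δ`, `κf(0) ≥ κ > 0`, and a window `δ₁ ≤ δ, ρ` with `κf > 0`, `μ(−1,·) < 1`;
* on the region `ℝ × (−δ₁, δ₁)`: the RIDGE LAW in the moving frame `B(Γ′,Γ′) + B(JΓ′,JΓ′) = −κf(z)` at `W(s,z)` (port-2's `horizLaplacian_two_eq_of_webFermat` +
  frame invariance of the trace) and the SLICE LAW `B(e₂,e₂) = −μ(−1,z)(B(Γ′,Γ′) + B(JΓ′,JΓ′))` (`plane_wave_identity`).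

These are exactly the inputs `hν, hT, hval, hridge, hslice, h0` of this seat's `…CurvedParallelWebs.curvedParallelWebs`; the remaining input (the Fermi factor
`1 − k(s)G ≠ 0` on a window) is the next file.  WHAT THIS IS NOT: not a claim about Navier–Stokes regularity — structure of a hypothetical object of research cell
(Q4); items 20428 / 19708 / 27893 OPEN.
-/

noncomputable section

-- the summit and its single sub-problem share the name (CONVENTIONS §1), as in every Theorems file
set_option linter.dupNamespace false

namespace Summit.NavierStokesRegularity.NavierStokesRegularity.Theorems.PoloidalWindowDoorLrcModEntireCurvedWebFunction

open Set Function Filter Topology Metric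
open scoped RealInnerProductSpace InnerProductSpace ContDiff
open Literature.Analysis Literature.Analysis.FluidPDE Literature.Analysis.UnboundedOperators
open Summit.NavierStokesRegularity.NavierStokesRegularity.Theorems.PoloidalWindowDoorLrcModEntireSheetFlattenTools
open Summit.NavierStokesRegularity.NavierStokesRegularity.Theorems.PoloidalWindowDoorLrcModEntireQ4LineTools
open Summit.NavierStokesRegularity.NavierStokesRegularity.Theorems.PoloidalWindowDoorLrcModEntireParallelWebsIdentity
open Summit.NavierStokesRegularity.NavierStokesRegularity.Theorems.PoloidalWindowDoorLrcModEntireRidgeWebLaw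
open Summit.NavierStokesRegularity.NavierStokesRegularity.Theorems.PoloidalWindowDoorLrcModEntireRidgeWebLawHoriz
open Summit.NavierStokesRegularity.NavierStokesRegularity.Theorems.PoloidalWindowDoorPoloidalWindowRigidityTimeHeightShearLinearSlice
open Summit.NavierStokesRegularity.NavierStokesRegularity.Theorems.PoloidalWindowDoorPoloidalWindowRigidityConstantShearSlice
open Summit.NavierStokesRegularity.NavierStokesRegularity.Theorems.PoloidalWindowDoorLrcModEntireTwistingTHSlopeSign
open Summit.NavierStokesRegularity.NavierStokesRegularity.Theorems.LocalSineTubeDoorProfileAlignedWindowRigidityAncient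
open Summit.NavierStokesRegularity.NavierStokesRegularity.Theorems.PoloidalWindowDoorLrcModEntireRidgeGlobalBranchODE
open Summit.NavierStokesRegularity.NavierStokesRegularity.Theorems.PoloidalWindowDoorLrcModEntireRidgeGlobalBranchFrame
open Summit.NavierStokesRegularity.NavierStokesRegularity.Theorems.PoloidalWindowDoorLrcModEntireRidgeGlobalBranchUnique
open Summit.NavierStokesRegularity.NavierStokesRegularity.Theorems.PoloidalWindowDoorLrcModEntirePlanarCurveRigidity
open Summit.NavierStokesRegularity.NavierStokesRegularity.Theorems.PoloidalWindowDoorLrcModEntireCurvedWebHuygens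
open Summit.NavierStokesRegularity.NavierStokesRegularity.Theorems.PoloidalWindowDoorLrcModEntireCurvedWebTools

/-- ★ **THE WEB FUNCTION OVER A CURVED BRANCH** (steps 1–9 of the Fermi-frame web package).  See the module docstring. -/
theorem curved_web_function {C : ℝ} {U : ℝ → EuclideanSpace ℝ (Fin 3) → EuclideanSpace ℝ (Fin 3)} {Γ νΓ : ℝ → EuclideanSpace ℝ (Fin 3)} {R μ : ℝ → ℝ → ℝ}
    {σ κ r δ ρ : ℝ}
    (hUrate : HasTypeITimeDecay C U) (hUcont : ContinuousOn (uncurry U) (Iio (0 : ℝ) ×ˢ univ))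
    (hUmild : ∀ s t : ℝ, s < t → t < 0 → ∀ x, U t x = heatExtension (U s) (t - s) x - oseenDuhamel 1 s U U t x)
    (hUdiv : ∀ t < 0, VectorCalculus.IsDivFree (U t))
    (hUpol : ∀ s < 0, ∀ q, ⟪curl (U s) q, EuclideanSpace.single 2 1⟫_ℝ = 0)
    (hUne : U (-1) 0 2 ≠ 0) (hUhotbd : ∀ t < 0, ∀ x, Real.sqrt (-t) * |U t x 2| ≤ |U (-1) 0 2|)
    (hUcrit : ∀ y ∈ {y : EuclideanSpace ℝ (Fin 3) | y 2 = 0 ∧ U (-1) y 2 = U (-1) 0 2}, fderiv ℝ (fun x => U (-1) x 2) y = 0)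
    (hσ : σ = 1 ∨ σ = -1) (hσN : σ * U (-1) 0 2 = |U (-1) 0 2|) (hκ : 0 < κ)
    (hΓ : ContDiff ℝ ∞ Γ) (hΓ2 : ∀ s, Γ s 2 = 0) (hΓunit : ∀ s, ‖deriv Γ s‖ = 1) (hΓhot : ∀ s, U (-1) (Γ s) 2 = U (-1) 0 2)
    (hν : ∀ s, νΓ s = WithLp.toLp 2 ![-(deriv Γ s 1), deriv Γ s 0, 0])
    (hΓcurv : ∀ s, κ ≤ -(fderiv ℝ (fderiv ℝ (fun y => σ * U (-1) y 2)) (Γ s) (νΓ s) (νΓ s)))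
    (hr : 0 < r) (hδ : 0 < δ)
    (hconc : ∀ τ z : ℝ, |τ| < δ → |z| < δ → ∀ s : ℝ, ∀ n ∈ Ioo (-r) r,
      fderiv ℝ (fderiv ℝ (fun y => σ * U (-1 + τ) y 2)) (Γ s + n • νΓ s + z • EuclideanSpace.single 2 (1 : ℝ)) (νΓ s) (νΓ s) < 0)
    (hweb : ∀ τ₀ z₀ : ℝ, |τ₀| < δ → |z₀| < δ → ∀ s₀ : ℝ, ∃ n₀ ∈ Ioo (-r) r,
      σ * U (-1 + τ₀) (Γ s₀ + n₀ • νΓ s₀ + z₀ • EuclideanSpace.single 2 (1 : ℝ)) 2 = R τ₀ z₀ ∧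
      (∀ n ∈ Icc (-r) r, n ≠ n₀ → σ * U (-1 + τ₀) (Γ s₀ + n • νΓ s₀ + z₀ • EuclideanSpace.single 2 (1 : ℝ)) 2 < R τ₀ z₀) ∧
      DifferentiableAt ℝ (uncurry R) (τ₀, z₀) ∧
      fderiv ℝ (uncurry fun τ y => σ * U (-1 + τ) y 2) (τ₀, Γ s₀ + n₀ • νΓ s₀ + z₀ • EuclideanSpace.single 2 (1 : ℝ)) =
        (fderiv ℝ (uncurry R) (τ₀, z₀)).comp
          ((ContinuousLinearMap.fst ℝ ℝ (EuclideanSpace ℝ (Fin 3))).prod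
            ((EuclideanSpace.proj (2 : Fin 3)).comp (ContinuousLinearMap.snd ℝ ℝ (EuclideanSpace ℝ (Fin 3))))))
    (hρ : 0 < ρ) (hμ3 : ContDiff ℝ 3 (uncurry μ))
    (hslabU : ∀ t : ℝ, |t + 1| < ρ → ∀ x : EuclideanSpace ℝ (Fin 3), |x 2| < ρ → ∀ b : Fin 3, b ≠ 2 →
      fderiv ℝ (U t) x (EuclideanSpace.single 2 1) b = μ t (x 2) * fderiv ℝ (U t) x (EuclideanSpace.single b 1) 2)
    (hevU : ∀ t₀ : ℝ, |t₀ + 1| < ρ → ∀ y₀ : EuclideanSpace ℝ (Fin 3), y₀ 2 = 0 →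
      ∀ᶠ z in 𝓝 ((t₀, y₀) : ℝ × EuclideanSpace ℝ (Fin 3)), ∀ b : Fin 3, b ≠ 2 →
        fderiv ℝ (U z.1) z.2 (EuclideanSpace.single 2 1) b = μ z.1 (z.2 2) * fderiv ℝ (U z.1) z.2 (EuclideanSpace.single b 1) 2) :
    ∃ (δ₁ : ℝ) (G : ℝ × ℝ → ℝ) (κf : ℝ → ℝ), 0 < δ₁ ∧ δ₁ ≤ δ ∧ δ₁ ≤ ρ ∧
      (∀ s : ℝ, G (s, 0) = 0) ∧
      (∀ p : ℝ × ℝ, |p.2| < δ → G p ∈ Ioo (-r) r) ∧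
      (∀ p : ℝ × ℝ, |p.2| < δ → ContDiffAt ℝ ∞ G p) ∧
      (∀ p : ℝ × ℝ, |p.2| < δ → σ * U (-1) (Γ p.1 + G p • rotJ (deriv Γ p.1) + p.2 • e2) 2 = R 0 p.2) ∧
      (∀ p : ℝ × ℝ, |p.2| < δ → ∀ n ∈ Icc (-r) r, n ≠ G p → σ * U (-1) (Γ p.1 + n • rotJ (deriv Γ p.1) + p.2 • e2) 2 < R 0 p.2) ∧
      (∀ p : ℝ × ℝ, |p.2| < δ → ∀ w : EuclideanSpace ℝ (Fin 3), w 2 = 0 →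
        fderiv ℝ (fun y => U (-1) y 2) (Γ p.1 + G p • rotJ (deriv Γ p.1) + p.2 • e2) w = 0) ∧
      (∀ p : ℝ × ℝ, |p.2| < δ →
        fderiv ℝ (fderiv ℝ (fun y => σ * U (-1) y 2)) (Γ p.1 + G p • rotJ (deriv Γ p.1) + p.2 • e2) (rotJ (deriv Γ p.1)) (rotJ (deriv Γ p.1)) < 0) ∧
      (∀ z : ℝ, |z| < δ → ContDiffAt ℝ ∞ (R 0) z) ∧
      (∀ z : ℝ, |z| < δ → DifferentiableAt ℝ κf z) ∧ κ ≤ κf 0 ∧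
      (∀ z ∈ Ioo (-δ₁) δ₁, |z| < δ ∧ |z| < ρ ∧ 0 < κf z ∧ μ (-1) z < 1) ∧
      (∀ p ∈ region (Ioo (-δ₁) δ₁),
        fderiv ℝ (fderiv ℝ (fun y => σ * U (-1) y 2)) (Γ p.1 + G p • rotJ (deriv Γ p.1) + p.2 • e2) (deriv Γ p.1) (deriv Γ p.1) +
          fderiv ℝ (fderiv ℝ (fun y => σ * U (-1) y 2)) (Γ p.1 + G p • rotJ (deriv Γ p.1) + p.2 • e2) (rotJ (deriv Γ p.1)) (rotJ (deriv Γ p.1)) =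
            -κf p.2) ∧
      (∀ p ∈ region (Ioo (-δ₁) δ₁),
        fderiv ℝ (fderiv ℝ (fun y => σ * U (-1) y 2)) (Γ p.1 + G p • rotJ (deriv Γ p.1) + p.2 • e2) e2 e2 =
          -μ (-1) p.2 * (fderiv ℝ (fderiv ℝ (fun y => σ * U (-1) y 2)) (Γ p.1 + G p • rotJ (deriv Γ p.1) + p.2 • e2) (deriv Γ p.1) (deriv Γ p.1) +
            fderiv ℝ (fderiv ℝ (fun y => σ * U (-1) y 2)) (Γ p.1 + G p • rotJ (deriv Γ p.1) + p.2 • e2) (rotJ (deriv Γ p.1)) (rotJ (deriv Γ p.1)))) := by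
  have hm1 : (-1 : ℝ) < 0 := by norm_num
  have h0δ : |(0 : ℝ)| < δ := by simpa using hδ
  /- STEP 1: the branch and its frame. -/
  have hΓ3 : ContDiff ℝ 3 Γ := hΓ.of_le (by norm_cast)
  have hΓc2 : ContDiff ℝ 2 Γ := hΓ.of_le (by norm_cast)
  have hΓd : ∀ t, HasDerivAt Γ (deriv Γ t) t := fun t => (hasDerivAt_of_contDiff_two hΓc2 t).1
  have hT2 : ∀ s, deriv Γ s 2 = 0 := fun s => (deriv_horizontal hΓc2 hΓ2 s).1
  have hTunit : ∀ s, deriv Γ s 0 ^ 2 + deriv Γ s 1 ^ 2 = 1 := fun s => sq_add_sq_of_horizontal_unit (hT2 s) (hΓunit s)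
  have hνJ : ∀ s, νΓ s = rotJ (deriv Γ s) := fun s => by rw [hν s]; rfl
  have hpt : ∀ s n z : ℝ, Γ s + n • νΓ s + z • EuclideanSpace.single 2 (1 : ℝ) = Γ s + n • rotJ (deriv Γ s) + z • e2 := fun s n z => by
    rw [hνJ s]; rfl
  set W : ℝ × ℝ → ℝ → EuclideanSpace ℝ (Fin 3) := fun p n => Γ p.1 + n • rotJ (deriv Γ p.1) + p.2 • e2 with hW
  have hW2 : ∀ p n, W p n 2 = p.2 := fun p n => by
    simp [hW, hΓ2, rotJ, e2]
  /- STEP 2: the signed component `F₀ = σU₂(−1,·)`, real-analytic. -/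
  obtain ⟨F₀, hF₀_def⟩ : ∃ F₀ : EuclideanSpace ℝ (Fin 3) → ℝ, F₀ = fun y => σ * U (-1) y 2 := ⟨_, rfl⟩
  have hUan : AnalyticOnNhd ℝ (U (-1)) univ := analyticOnNhd_slice hUcont (bdd_of_hasTypeITimeDecay hUrate) hUmild hm1
  have hU2 : ContDiff ℝ 2 (U (-1)) := hUan.contDiff
  have hUd : Differentiable ℝ (U (-1)) := hU2.differentiable (by norm_num)
  have hθan : AnalyticOnNhd ℝ (fun y => U (-1) y 2) univ := fun x _ =>
    ((EuclideanSpace.proj (𝕜 := ℝ) (2 : Fin 3)).analyticAt _).comp (hUan x (mem_univ _))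
  have hθ2 : ContDiff ℝ 2 (fun y => U (-1) y 2) := hθan.contDiff
  have hF₀an : AnalyticOnNhd ℝ F₀ univ := by
    rw [hF₀_def]; exact fun x hx => analyticAt_const.mul (hθan x hx)
  have hF₀ω : ContDiff ℝ ω F₀ := hF₀an.contDiff
  have hF₀i : ContDiff ℝ ∞ F₀ := hF₀an.contDiff
  have hF₀2 : ContDiff ℝ 2 F₀ := hF₀an.contDiff
  have hF₀1 : ContDiff ℝ 1 F₀ := hF₀an.contDiff
  have hF₀d : Differentiable ℝ F₀ := hF₀2.differentiable (by norm_num)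
  have hD2ω : ContDiff ℝ ω (fderiv ℝ (fderiv ℝ F₀)) :=
    (hF₀ω.fderiv_right (m := ω) le_rfl).fderiv_right (m := ω) le_rfl
  have hF₀fd : ∀ x w, fderiv ℝ F₀ x w = σ * fderiv ℝ (fun y => U (-1) y 2) x w := by
    intro x w; rw [hF₀_def, fderiv_const_mul ((hθ2.differentiable (by norm_num)) x)]; simp
  /- STEP 3: the web function (chosen maximiser) and the web Fermat data. -/
  have hS : ∀ z : ℝ, |z| < δ → ∀ s : ℝ, ∃ n₀ ∈ Ioo (-r) r, F₀ (W (s, z) n₀) = R 0 z ∧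
      ∀ n ∈ Icc (-r) r, n ≠ n₀ → F₀ (W (s, z) n) < R 0 z := by
    intro z hz s
    obtain ⟨n₀, hn₀, hval, huniq, -, -⟩ := hweb 0 z h0δ hz s
    simp only [add_zero] at hval huniq
    refine ⟨n₀, hn₀, ?_, fun n hn hne => ?_⟩
    · rw [hF₀_def, hW]; simp only; rw [← hpt]; exact hval
    · rw [hF₀_def, hW]; simp only; rw [← hpt]; exact huniq n hn hne
  choose! G0 hG0 using hS
  set G : ℝ × ℝ → ℝ := fun p => G0 p.2 p.1 with hG_def
  have hspec : ∀ p : ℝ × ℝ, |p.2| < δ → G p ∈ Ioo (-r) r ∧ F₀ (W p (G p)) = R 0 p.2 ∧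
      ∀ n ∈ Icc (-r) r, n ≠ G p → F₀ (W p n) < R 0 p.2 := fun p hp => hG0 p.2 hp p.1
  have hAweb : ∀ p : ℝ × ℝ, |p.2| < δ → DifferentiableAt ℝ (uncurry R) (0, p.2) ∧
      fderiv ℝ (uncurry fun τ y => σ * U (-1 + τ) y 2) (0, W p (G p)) =
        (fderiv ℝ (uncurry R) (0, p.2)).comp ((ContinuousLinearMap.fst ℝ ℝ (EuclideanSpace ℝ (Fin 3))).prod
          ((EuclideanSpace.proj (2 : Fin 3)).comp (ContinuousLinearMap.snd ℝ ℝ (EuclideanSpace ℝ (Fin 3))))) := by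
    intro p hp
    obtain ⟨n₁, hn₁, hval₁, -, hRd, hfd⟩ := hweb 0 p.2 h0δ hp p.1
    have hn : n₁ = G p := by
      by_contra hne
      have hlt := (hspec p hp).2.2 n₁ (Ioo_subset_Icc_self hn₁) hne
      simp only [add_zero] at hval₁
      rw [hpt] at hval₁
      simp only [hF₀_def, hW] at hlt
      exact absurd hval₁ hlt.ne
    refine ⟨hRd, ?_⟩
    rw [hpt, hn] at hfd
    exact hfd
  have hgrad : ∀ p : ℝ × ℝ, |p.2| < δ → fderiv ℝ (U (-1)) (W p (G p)) (EuclideanSpace.single 0 1) 2 = 0 ∧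
      fderiv ℝ (U (-1)) (W p (G p)) (EuclideanSpace.single 1 1) 2 = 0 := by
    intro p hp
    have h := webData_of_fderiv_uncurry hUrate hUcont hUmild hUdiv hσ (τ₀ := 0) (by norm_num) (hAweb p hp).2 (hAweb p hp).2 rfl
    simp only [add_zero] at h
    exact ⟨h.2.2.2.1, h.2.2.2.2.1⟩
  have hhoriz : ∀ p : ℝ × ℝ, |p.2| < δ → ∀ w : EuclideanSpace ℝ (Fin 3), w 2 = 0 →
      fderiv ℝ (fun y => U (-1) y 2) (W p (G p)) w = 0 := fun p hp w hw =>
    fderiv_two_horizontal_eq_zero (hUd _) (hgrad p hp).1 (hgrad p hp).2 hw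
  /- STEP 4: `G(s,0) = 0` (hot value on `Γ`, hot bound). -/
  have hF₀le : ∀ x, F₀ x ≤ σ * U (-1) 0 2 := by
    intro x
    have h1 : F₀ x ≤ |U (-1) x 2| := by
      rw [hF₀_def]; simp only
      rcases hσ with h | h
      · rw [h, one_mul]; exact le_abs_self _
      · rw [h, neg_one_mul]; exact neg_le_abs _
    have h2 := hUhotbd (-1) hm1 x
    rw [neg_neg, Real.sqrt_one, one_mul] at h2
    rw [hσN]
    exact h1.trans h2
  have hWΓ : ∀ s, W (s, 0) 0 = Γ s := fun s => by simp [hW]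
  have hF₀Γ : ∀ s, F₀ (W (s, 0) 0) = σ * U (-1) 0 2 := by
    intro s; rw [hWΓ, hF₀_def]; simp only; rw [hΓhot s]
  have hG0z : ∀ s : ℝ, G (s, 0) = 0 := by
    intro s
    have hp : |((s, (0 : ℝ)) : ℝ × ℝ).2| < δ := by simpa using hδ
    obtain ⟨-, hval, huniq⟩ := hspec (s, 0) hp
    by_contra hne
    have hlt := huniq 0 ⟨by linarith [hr], by linarith [hr]⟩ (Ne.symm hne)
    rw [hF₀Γ] at hlt
    linarith [hF₀le (W (s, 0) (G (s, 0)))]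
  /- STEP 5: strict concavity along `ν`; the web function is `C^∞` on `|z| < δ`. -/
  have hconcF : ∀ p : ℝ × ℝ, |p.2| < δ → ∀ n ∈ Ioo (-r) r,
      fderiv ℝ (fderiv ℝ F₀) (W p n) (rotJ (deriv Γ p.1)) (rotJ (deriv Γ p.1)) < 0 := by
    intro p hp n hn
    have h := hconc 0 p.2 h0δ hp p.1 n hn
    simp only [add_zero] at h
    rw [← hF₀_def, hpt, hνJ] at h
    exact h
  set V : Set (ℝ × ℝ) := {p | |p.2| < δ} with hV
  have hVo : IsOpen V := isOpen_lt (continuous_abs.comp continuous_snd) continuous_const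
  have hsec : ContDiff ℝ ∞ (fun v : (ℝ × ℝ) × ℝ => F₀ (Γ v.1.1 + v.2 • rotJ (deriv Γ v.1.1) + v.1.2 • e2)) :=
    contDiff_curvedSection (n := ∞) hF₀i (by simpa using hΓ)
  have hνcrit : ∀ p : ℝ × ℝ, |p.2| < δ → fderiv ℝ F₀ (W p (G p)) (rotJ (deriv Γ p.1)) = 0 := fun p hp =>
    fderiv_normal_eq_zero_of_strictMax hF₀d (hspec p hp).1 (hspec p hp).2.1 (hspec p hp).2.2
  have hGi : ∀ p : ℝ × ℝ, |p.2| < δ → ContDiffAt ℝ ∞ G p := by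
    intro p₀ hp₀
    refine contDiffAt_criticalPoint_of_contDiffAt (G := fun v : (ℝ × ℝ) × ℝ => F₀ (Γ v.1.1 + v.2 • rotJ (deriv Γ v.1.1) + v.1.2 • e2))
      hVo (r := r) (m := ∞) (n := ∞) (by simp) (by simp) (fun p _ n _ => hsec.contDiffAt) ?_ ?_ ?_ hp₀
    · intro p hp n hn
      rw [fderiv_fderiv_curvedSection_fibre hF₀2 hΓ3]
      exact hconcF p hp n hn
    · exact fun p hp => (hspec p hp).1
    · intro p hp
      rw [fderiv_curvedSection_fibre hF₀1 hΓc2]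
      exact hνcrit p hp
  -- the web map `p ↦ W p (G p)` and the base web `z ↦ W (0,z) (G (0,z))` are `C^∞`
  have hTi : ContDiff ℝ ∞ (deriv Γ) := hΓ.deriv'
  have hWi : ∀ p : ℝ × ℝ, |p.2| < δ → ContDiffAt ℝ ∞ (fun q : ℝ × ℝ => W q (G q)) p := by
    intro p hp
    simp only [hW]
    exact (((hΓ.contDiffAt.comp p contDiffAt_fst).add ((hGi p hp).smul (contDiff_rotJ.contDiffAt.comp p
      (hTi.contDiffAt.comp p contDiffAt_fst)))).add (contDiffAt_snd.smul contDiffAt_const))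
  have hW0i : ∀ z : ℝ, |z| < δ → ContDiffAt ℝ ∞ (fun z : ℝ => W ((0 : ℝ), z) (G ((0 : ℝ), z))) z := fun z hz =>
    (hWi ((0 : ℝ), z) hz).comp z (contDiffAt_const.prodMk contDiffAt_id)
  have hRi : ∀ z : ℝ, |z| < δ → ContDiffAt ℝ ∞ (R 0) z := by
    intro z hz
    refine ((hF₀i.contDiffAt).comp z (hW0i z hz)).congr_of_eventuallyEq ?_
    filter_upwards [(isOpen_lt continuous_abs continuous_const).mem_nhds (hz : z ∈ {z' : ℝ | |z'| < δ})] with z' hz'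
    rw [Function.comp_apply]; exact ((hspec (0, z') hz').2.1).symm
  /- STEP 6: the slope function at `t = −1`: `C¹`, `μ(−1,0) ≤ 0`. -/
  have hμfun : μ (-1) = uncurry μ ∘ fun z : ℝ => ((-1 : ℝ), z) := by funext z; rfl
  have hμd : ∀ z : ℝ, DifferentiableAt ℝ (μ (-1)) z := fun z => by
    rw [hμfun]; exact ((hμ3.differentiable (by norm_num)) _).comp z ((differentiableAt_const _).prodMk differentiableAt_id)
  have hslabU1 : ∀ x : EuclideanSpace ℝ (Fin 3), |x 2| < ρ → ∀ b : Fin 3, b ≠ 2 →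
      fderiv ℝ (U (-1)) x (EuclideanSpace.single 2 1) b = μ (-1) (x 2) * fderiv ℝ (U (-1)) x (EuclideanSpace.single b 1) 2 :=
    fun x hx b hb => hslabU (-1) (by simp [hρ]) x hx b hb
  have hplane : ∀ z : ℝ, |z| < ρ → ∀ y : EuclideanSpace ℝ (Fin 3), y 2 = z → ∀ b : Fin 3, b ≠ 2 →
      fderiv ℝ (U (-1)) y (EuclideanSpace.single 2 (1 : ℝ)) b = μ (-1) z * fderiv ℝ (U (-1)) y (EuclideanSpace.single b (1 : ℝ)) 2 := by
    intro z hz y hy b hb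
    have h := hslabU1 y (by rw [hy]; exact hz) b hb
    rw [hy] at h; exact h
  have hμle : μ (-1) 0 ≤ 0 :=
    slopeFunction_nonpos hUrate hUcont hUmild hUdiv hUpol hUne hUhotbd hμ3.continuous (hevU (-1) (by simp [hρ]) 0 rfl)
  /- STEP 7: frame form of the horizontal Laplacian (any frame `(Γ′ s, JΓ′ s)`) and the slice law for `F₀`. -/
  have hframe : ∀ (s : ℝ) (x : EuclideanSpace ℝ (Fin 3)),
      fderiv ℝ (fderiv ℝ F₀) x (deriv Γ s) (deriv Γ s) + fderiv ℝ (fderiv ℝ F₀) x (rotJ (deriv Γ s)) (rotJ (deriv Γ s)) =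
        σ * (fderiv ℝ (fun w => fderiv ℝ (fun y => U (-1) y 2) w (EuclideanSpace.single 0 (1 : ℝ))) x (EuclideanSpace.single 0 (1 : ℝ)) +
          fderiv ℝ (fun w => fderiv ℝ (fun y => U (-1) y 2) w (EuclideanSpace.single 1 (1 : ℝ))) x (EuclideanSpace.single 1 (1 : ℝ))) := by
    intro s x
    rw [← Jvec_eq_rotJ, bilin_frame_trace (fderiv ℝ (fderiv ℝ F₀) x) (hT2 s) (hTunit s), ← nested_eq_fderiv_fderiv hF₀2,
      ← nested_eq_fderiv_fderiv hF₀2, hF₀_def, nested_const_mul hθ2, nested_const_mul hθ2]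
    ring
  have hslice₀ : ∀ (s : ℝ) (x : EuclideanSpace ℝ (Fin 3)), |x 2| < ρ →
      fderiv ℝ (fderiv ℝ F₀) x e2 e2 =
        -μ (-1) (x 2) * (fderiv ℝ (fderiv ℝ F₀) x (deriv Γ s) (deriv Γ s) + fderiv ℝ (fderiv ℝ F₀) x (rotJ (deriv Γ s)) (rotJ (deriv Γ s))) := by
    intro s x hx
    have hpw := plane_wave_identity hU2 (fun y => div_coord (hUdiv (-1) hm1) y) (hplane (x 2) hx) (x := x) rfl
    rw [hframe, ← nested_eq_fderiv_fderiv hF₀2, hF₀_def, show e2 = EuclideanSpace.single 2 (1 : ℝ) from rfl,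
      nested_const_mul hθ2, hpw]
    ring
  /- STEP 8: the curvature function `κf(z) = −ΔₕF₀` on the base web, the height window `δ₁`. -/
  obtain ⟨κf, hκf_def⟩ : ∃ κf : ℝ → ℝ, κf = fun z => -(fderiv ℝ (fderiv ℝ F₀) (W ((0 : ℝ), z) (G ((0 : ℝ), z))) (deriv Γ 0) (deriv Γ 0) +
      fderiv ℝ (fderiv ℝ F₀) (W ((0 : ℝ), z) (G ((0 : ℝ), z))) (rotJ (deriv Γ 0)) (rotJ (deriv Γ 0))) := ⟨_, rfl⟩
  have hκfd : ∀ z : ℝ, |z| < δ → DifferentiableAt ℝ κf z := by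
    intro z hz
    have h1 : DifferentiableAt ℝ (fderiv ℝ (fderiv ℝ F₀) ∘ fun z : ℝ => W ((0 : ℝ), z) (G ((0 : ℝ), z))) z :=
      (((hD2ω.of_le le_top).contDiffAt).comp z (hW0i z hz)).differentiableAt (by simp)
    rw [hκf_def]
    exact ((h1.clm_apply (differentiableAt_const _)).clm_apply (differentiableAt_const _)).add
      ((h1.clm_apply (differentiableAt_const _)).clm_apply (differentiableAt_const _)) |>.neg
  -- criticality on the hot set, kernel direction along `Γ`
  have hhot_iff : ∀ y : EuclideanSpace ℝ (Fin 3), F₀ y = σ * U (-1) 0 2 ↔ U (-1) y 2 = U (-1) 0 2 := fun y => by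
    have hσ0 : σ ≠ 0 := by rcases hσ with h | h <;> simp [h]
    rw [hF₀_def]; exact mul_right_inj' hσ0
  have hcritf : ∀ y : EuclideanSpace ℝ (Fin 3), y 2 = 0 → F₀ y = σ * U (-1) 0 2 → fderiv ℝ F₀ y = 0 := by
    intro y hy2 hyM
    have h := hUcrit y ⟨hy2, (hhot_iff y).1 hyM⟩
    rw [hF₀_def, show (fun y => σ * U (-1) y 2) = fun x => σ * (fun x => U (-1) x 2) x from rfl,
      fderiv_const_mul ((hθ2.differentiable (by norm_num)) y), h, smul_zero]
  have hkerΓ : ∀ s w, fderiv ℝ (fderiv ℝ F₀) (Γ s) (deriv Γ s) w = 0 := fun s w =>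
    hessian_apply_deriv_eq_zero_of_hot hF₀2 hcritf (hΓd s) hΓ2 (fun s => (hhot_iff _).2 (hΓhot s)) w
  have hW00 : W ((0 : ℝ), 0) (G ((0 : ℝ), 0)) = Γ 0 := by rw [hG0z 0]; exact hWΓ 0
  have hκf0 : κ ≤ κf 0 := by
    have hνν := hΓcurv 0
    rw [hνJ, ← hF₀_def] at hνν
    rw [hκf_def]; simp only; rw [hW00, hkerΓ 0, zero_add]
    exact hνν
  have hκpos0 : 0 < κf 0 := lt_of_lt_of_le hκ hκf0
  obtain ⟨ε, hε, hball⟩ : ∃ ε > 0, ∀ z : ℝ, |z| < ε → 0 < κf z ∧ μ (-1) z < 1 := by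
    have h1 : ∀ᶠ z in 𝓝 (0 : ℝ), 0 < κf z := (hκfd 0 h0δ).continuousAt.eventually_const_lt hκpos0
    have h2 : ∀ᶠ z in 𝓝 (0 : ℝ), μ (-1) z < 1 := (hμd 0).continuousAt.eventually_lt_const (by linarith)
    obtain ⟨ε, hε, h⟩ := Metric.eventually_nhds_iff.1 (h1.and h2)
    exact ⟨ε, hε, fun z hz => h (by simpa [Real.dist_eq] using hz)⟩
  set δ₁ : ℝ := min (min δ ρ) ε with hδ₁_def
  have hδ₁ : 0 < δ₁ := lt_min (lt_min hδ hρ) hε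
  have hδ₁δ : δ₁ ≤ δ := (min_le_left _ _).trans (min_le_left _ _)
  have hδ₁ρ : δ₁ ≤ ρ := (min_le_left _ _).trans (min_le_right _ _)
  have hI : ∀ z ∈ Ioo (-δ₁) δ₁, |z| < δ ∧ |z| < ρ ∧ 0 < κf z ∧ μ (-1) z < 1 := by
    intro z hz
    have hz' : |z| < δ₁ := abs_lt.2 hz
    exact ⟨lt_of_lt_of_le hz' hδ₁δ, lt_of_lt_of_le hz' hδ₁ρ, hball z (lt_of_lt_of_le hz' (min_le_right _ _))⟩
  /- STEP 9: the ridge law and the slice law on the region `ℝ × (−δ₁, δ₁)`. -/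
  have hridge : ∀ p ∈ region (Ioo (-δ₁) δ₁),
      fderiv ℝ (fderiv ℝ F₀) (W p (G p)) (deriv Γ p.1) (deriv Γ p.1) +
        fderiv ℝ (fderiv ℝ F₀) (W p (G p)) (rotJ (deriv Γ p.1)) (rotJ (deriv Γ p.1)) = -κf p.2 := by
    intro p hp
    obtain ⟨hzδ, hzρ, -, hμ1⟩ := hI p.2 hp
    have hzδ' : |((0 : ℝ), p.2).2| < δ := hzδ
    have hO : IsOpen ({q : ℝ × EuclideanSpace ℝ (Fin 3) | |q.1 + 1| < ρ} ∩ {q | |q.2 2| < ρ}) :=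
      (isOpen_lt (continuous_abs.comp (continuous_fst.add continuous_const)) continuous_const).inter
        (isOpen_lt (continuous_abs.comp ((EuclideanSpace.proj (𝕜 := ℝ) (2 : Fin 3)).continuous.comp continuous_snd))
          continuous_const)
    have hslopeEv : ∀ y : EuclideanSpace ℝ (Fin 3), y 2 = (W p (G p)) 2 →
        ∀ᶠ q in 𝓝 ((-1 + 0, y) : ℝ × EuclideanSpace ℝ (Fin 3)), ∀ b : Fin 3, b ≠ 2 →
          fderiv ℝ (U q.1) q.2 (EuclideanSpace.single 2 1) b = μ q.1 (q.2 2) * fderiv ℝ (U q.1) q.2 (EuclideanSpace.single b 1) 2 := by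
      intro y hy
      have hmem : ((-1 + 0 : ℝ), y) ∈ ({q : ℝ × EuclideanSpace ℝ (Fin 3) | |q.1 + 1| < ρ} ∩ {q | |q.2 2| < ρ}) := by
        refine ⟨by simp [hρ], ?_⟩
        show |y 2| < ρ
        rw [hy, hW2]; exact hzρ
      exact Filter.eventually_of_mem (hO.mem_nhds hmem) fun q hq => hslabU q.1 hq.1 q.2 hq.2
    have hplane' : ∀ y : EuclideanSpace ℝ (Fin 3), y 2 = (W p (G p)) 2 → ∀ b : Fin 3, b ≠ 2 →
        fderiv ℝ (U (-1 + 0)) y (EuclideanSpace.single 2 1) b =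
          μ (-1 + 0) ((W p (G p)) 2) * fderiv ℝ (U (-1 + 0)) y (EuclideanSpace.single b 1) 2 := by
      intro y hy b hb
      rw [add_zero, hW2]
      exact hplane p.2 hzρ y (by rw [hy, hW2]) b hb
    have hμ1' : μ (-1 + 0) ((W p (G p)) 2) ≠ 1 := by rw [add_zero, hW2]; exact hμ1.ne
    have hvalEq : σ * U (-1 + 0) (W p (G p)) 2 = σ * U (-1 + 0) (W ((0 : ℝ), p.2) (G ((0 : ℝ), p.2))) 2 := by
      have h1 := (hspec p hzδ).2.1
      have h2 := (hspec ((0 : ℝ), p.2) hzδ').2.1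
      rw [hF₀_def] at h1 h2
      simp only at h1 h2
      rw [add_zero, h1, h2]
    have h := horizLaplacian_two_eq_of_webFermat hUrate hUcont hUmild hUdiv hUpol hμ3 (τ₀ := 0) (by norm_num)
      (p := W p (G p)) (p' := W ((0 : ℝ), p.2) (G ((0 : ℝ), p.2))) (by rw [hW2, hW2]) hslopeEv hplane' hμ1' hσ
      (hAweb p hzδ).2 (hAweb ((0 : ℝ), p.2) hzδ').2 hvalEq
    simp only [add_zero] at h
    rw [hκf_def]; simp only
    rw [hframe p.1, hframe 0, h, neg_neg]
  have hslice : ∀ p ∈ region (Ioo (-δ₁) δ₁), fderiv ℝ (fderiv ℝ F₀) (W p (G p)) e2 e2 =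
      -μ (-1) p.2 * (fderiv ℝ (fderiv ℝ F₀) (W p (G p)) (deriv Γ p.1) (deriv Γ p.1) +
        fderiv ℝ (fderiv ℝ F₀) (W p (G p)) (rotJ (deriv Γ p.1)) (rotJ (deriv Γ p.1))) := by
    intro p hp
    have h := hslice₀ p.1 (W p (G p)) (by rw [hW2]; exact (hI p.2 hp).2.1)
    rw [hW2] at h; exact h
  /- ASSEMBLE. -/
  refine ⟨δ₁, G, κf, hδ₁, hδ₁δ, hδ₁ρ, hG0z, fun p hp => (hspec p hp).1, hGi, fun p hp => ?_, fun p hp n hn hne => ?_, hhoriz, fun p hp => ?_,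
    hRi, hκfd, hκf0, hI, fun p hp => ?_, fun p hp => ?_⟩
  · have h := (hspec p hp).2.1; rw [hF₀_def] at h; exact h
  · have h := (hspec p hp).2.2 n hn hne; rw [hF₀_def] at h; exact h
  · have h := hconcF p hp (G p) (hspec p hp).1; rw [hF₀_def] at h; exact h
  · have h := hridge p hp; rw [hF₀_def] at h; exact h
  · have h := hslice p hp; rw [hF₀_def] at h; exact h

end Summit.NavierStokesRegularity.NavierStokesRegularity.Theorems.PoloidalWindowDoorLrcModEntireCurvedWebFunction
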